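import Summits.NavierStokesRegularity.NavierStokesRegularity.Theorems.SymmetryModuliCountHelicalEndLiouvilleLineLiouvilleEnd
import HarnessLib

/-!
# Crux `ClockStretchingLaw.ClockCeiling` (stmt-NavierStokesRegularity-10570), line `registered`:
# stub `stub_shearLiouville` — a Type-I ancient mild field invariant along a direction vanishes

An element `u` of the route's Type-I class (jointly smooth on `(-∞,0) × ℝ³`, divergence free,
KNSS-mild Oseen identity between all pairs of negative times, `‖u(t,x)‖ ≤ C/√(-t)`, local
energies) which is invariant under the translations along a direction `b ≠ 0` is identically
zero. The first four clauses of the class hypothesis are, definitionally, the tree class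
`Literature.Analysis.FluidPDE.IsTypeIAncientMild C u` (`isTypeIAncientMild_iff`; the written-out
kernel is `oseenKernel`), and for that class the statement is the landed direction-free 2.5-D
leaf `stub_lineLiouvilleEnd` (file `SymmetryModuliCountHelicalEndLiouvilleLineLiouvilleEnd`) on
the end `T = 0`: rotate `b` onto `‖b‖ e₂` by a Householder reflection (rotation covariance of
the class), shift time by `ε > 0` into the past (the field becomes bounded by `C/√ε`), and apply
the proved Liouville step of KNSS 2009, Thm 6.2, `KNSS2009_typeI_rate_liouville_holds` (an
`x₂`-independent bounded ancient mild field with `√(-t)|u| ≤ C` vanishes). The fifth clause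
(local energies) is not used.

References: G. Koch, N. Nadirashvili, G. Seregin, V. Šverák, Acta Math. 203 (2009), proof of
Thm 6.2 (arXiv:0709.3599 p. 13) with Thm 5.1 (p. 9) and Remark 6.1 (p. 11).
-/

-- the summit and its single sub-problem share the name (CONVENTIONS §1), as in every Theorems file
set_option linter.dupNamespace false

noncomputable section

namespace Summit.NavierStokesRegularity.NavierStokesRegularity.Theorems

open Literature.Analysis.FluidPDE

/-- **Stub `stub_shearLiouville` — a class element invariant along a direction vanishes.** For
an element `u` of the route's Type-I class and `b ≠ 0` with `u(t, x + h b) = u(t, x)` for all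
`t < 0`, `x`, `h`: `u ≡ 0` on `t < 0`. Proof: the first four clauses are `IsTypeIAncientMild C u`
(`isTypeIAncientMild_iff`), and the landed leaf `stub_lineLiouvilleEnd` with `T = 0` (rotate `b`
onto `‖b‖ e₂`, shift time into the past, apply the proved Liouville step of KNSS 2009, Thm 6.2,
`KNSS2009_typeI_rate_liouville_holds`: an `x₂`-independent bounded ancient mild field with
`√(-t)|u| ≤ C` is zero — Thm 5.1 + Remark 6.1 + the caloric Liouville theorem). [cite: KochNadirashviliSereginSverak2009, proof of Thm 6.2 (arXiv p. 13) with Thm 5.1 (p. 9) and Remark 6.1 (p. 11)] -/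
theorem stub_shearLiouville :
    ∀ (C : ℝ) (u : ℝ → EuclideanSpace ℝ (Fin 3) → EuclideanSpace ℝ (Fin 3)), ContDiffOn ℝ (⊤ : ℕ∞) (Function.uncurry u) (Set.Iio 0 ×ˢ Set.univ) ∧ (∀ t < 0, Literature.Analysis.FluidPDE.VectorCalculus.IsDivFree (u t)) ∧ (∀ s t : ℝ, s < t → t < 0 → ∀ x, u t x = Literature.Analysis.FluidPDE.heatFlow (u s) (t - s) x - ∫ τ in Set.Ioo s t, ∫ y, ((-(inner ℝ (x - y) (u τ y) / (2 * (t - τ)) * Literature.Analysis.UnboundedOperators.heatKernel (t - τ) (x - y))) • u τ y + (∫ σ in Set.Ioi (t - τ), Literature.Analysis.UnboundedOperators.heatKernel σ (x - y) / (4 * σ ^ 2)) • (inner ℝ (x - y) (u τ y) • u τ y + inner ℝ (u τ y) (u τ y) • (x - y) + inner ℝ (x - y) (u τ y) • u τ y) - ((∫ σ in Set.Ioi (t - τ), Literature.Analysis.UnboundedOperators.heatKernel σ (x - y) / (8 * σ ^ 3)) * (inner ℝ (x - y) (u τ y) * inner ℝ (x - y) (u τ y))) • (x - y))) ∧ Literature.Analysis.FluidPDE.HasTypeITimeDecay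 C u ∧ (∀ (x₀ : EuclideanSpace ℝ (Fin 3)) (t₀ r : ℝ), t₀ ≤ 0 → 0 < r → (∀ t, t₀ - r ^ 2 < t → t < t₀ → r⁻¹ * ∫ x in Metric.ball x₀ r, ‖u t x‖ ^ 2 ≤ C) ∧ r⁻¹ * ∫ t in Set.Ioo (t₀ - r ^ 2) t₀, ∫ x in Metric.ball x₀ r, ‖fderiv ℝ (u t) x‖ ^ 2 ≤ C) → ∀ b : EuclideanSpace ℝ (Fin 3), b ≠ 0 → (∀ t : ℝ, t < 0 → ∀ (x : EuclideanSpace ℝ (Fin 3)) (h : ℝ), u t (x + h • b) = u t x) → ∀ t : ℝ, t < 0 → ∀ x, u t x = 0 := by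
  intro C u hu b hb hshift t ht x
  -- the first four clauses are the class `IsTypeIAncientMild C u` (the kernel is `oseenKernel`)
  have hTI : IsTypeIAncientMild C u :=
    isTypeIAncientMild_iff.2 ⟨hu.1, hu.2.1, hu.2.2.1, hu.2.2.2.1⟩
  exact stub_lineLiouvilleEnd C u hTI b 0 hb le_rfl hshift t ht x

end Summit.NavierStokesRegularity.NavierStokesRegularity.Theorems

end
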